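import Summits.QuantumFields.YangMills.Theorems.ColdStartUniversalityLatticeLangevinHeatKernelSU2
import Summits.QuantumFields.YangMills.Theorems.ColdStartUniversalityLatticeLangevinChebyshevSpan
import HarnessLib

/-!
# Route `ColdStartUniversality` (fixed-cut-off package, `β' = 0`): a LOCAL LOWER BOUND of the SU(2) heat kernel near the identity
# at every time — `h_t(U) ≥ h_t(1) − (1 − Re tr U / 2) · D_t`

Helper file (seat `ym-line-csu-p1`, g11, free hands).  Second brick towards the Doeblin minorisation of the SZZ kernels at SMALL
lattice times (first brick: `…HeatKernelLawAllTimes`, the law is the heat-kernel density for all `t > 0` and `h_t ≥ 0`; the third,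
NOT done here, is the spreading argument `h_{2t} = h_t * h_t` along square roots in `SU(2)`).  The character series
`h_t(U) = Σ (n+1) e^{-n(n+2)t/2} U_n(Re tr U/2)` is controlled near `U = 1` by the Chebyshev deficiency:

* (`gegenbauerSum_one_succ_succ`, tree) — `U_{n+2} = 2x U_{n+1} − U_n`;
* ★ `gegenbauerSum_one_deficiency` — the identity `(n+1) − U_n(x) = (1 − x) · Σ_{k<n} 2(k+1) U_{n-1-k}(x)` (variation of
  constants for the inhomogeneous Chebyshev recurrence satisfied by the deficiency);
* ★ `sub_gegenbauerSum_one_le` — for `|x| ≤ 1`: `(n+1) − U_n(x) ≤ (1 − x) · n(n+1)(n+2)/3` (`|U_j| ≤ j+1` and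
  `Σ_{k<n} 2(k+1)(n−k) = n(n+1)(n+2)/3`), a quadratic (in the distance to `1`) Markov-type bound;
* `summable_heatKernelSU2_deficiencyMajorant` — `D_t = Σ (n+1) e^{-n(n+2)t/2} n(n+1)(n+2)/3 < ∞`;
* ★ `heatKernelSU2_one_sub_le` — `h_t(1) − h_t(U) ≤ (1 − Re tr U / 2) · D_t` for every `U ∈ SU(2)`, `t > 0`: the kernel stays
  above `h_t(1)/2` on the ball `{1 − Re tr U/2 ≤ h_t(1)/(2 D_t)}` (`heatKernelSU2_ge_half_of_near_one`).

THEOREMS ONLY, [folklore]; RECORD-rung R3 plumbing; no crux, rung or summit is proved; the Yang–Mills mass gap is NOT proved.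
-/

set_option autoImplicit false

noncomputable section

namespace Summit.QuantumFields.YangMills.Theorems.ColdStartUniversality

open Finset Filter
open scoped BigOperators Topology
open Literature.MathematicalPhysics.QuantumFieldTheory
open Literature.MathematicalPhysics.QuantumFieldTheory.Tomboulis2007 (su2Char)
open Literature.Analysis.SpecialFunctions (gegenbauerSum gegenbauerSum_rec gegenbauerSum_one gegenbauerSum_zero)

/-! ## The Chebyshev deficiency `(n+1) − U_n(x)` -/

/-- ★ **The deficiency identity**: `(n+1) − U_n(x) = (1 − x) · Σ_{k<n} 2(k+1) U_{n−1−k}(x)` for every real `x` — the deficiency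
solves `e_{n+2} − 2x e_{n+1} + e_n = 2(n+2)(1−x)`, `e_0 = 0`, `e_1 = 2(1−x)`, and so does the right-hand side. [folklore] -/
theorem gegenbauerSum_one_deficiency (x : ℝ) (n : ℕ) :
    ((n : ℝ) + 1) - gegenbauerSum 1 n x =
      (1 - x) * ∑ k ∈ Finset.range n, 2 * ((k : ℝ) + 1) * gegenbauerSum 1 (n - 1 - k) x := by
  induction n using Nat.twoStepInduction with
  | zero => simp
  | one =>
    rw [Finset.sum_range_one, gegenbauerSum_one]
    simp only [Nat.cast_zero, Nat.cast_one, Nat.sub_self, gegenbauerSum_zero]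
    ring
  | more n ih0 ih1 =>
    -- peel the two top terms of the sums at `n + 2` and `n + 1`
    have hS2 : ∑ k ∈ Finset.range (n + 2), 2 * ((k : ℝ) + 1) * gegenbauerSum 1 (n + 2 - 1 - k) x =
        (∑ k ∈ Finset.range n, 2 * ((k : ℝ) + 1) * gegenbauerSum 1 (n - 1 - k + 2) x) +
          2 * ((n : ℝ) + 1) * gegenbauerSum 1 1 x + 2 * ((n : ℝ) + 2) * gegenbauerSum 1 0 x := by
      have e1 : n + 2 - 1 - n = 1 := by omega
      have e2 : n + 2 - 1 - (n + 1) = 0 := by omega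
      rw [Finset.sum_range_succ, Finset.sum_range_succ, e1, e2]
      have hcast : (((n + 1 : ℕ) : ℝ) + 1) = (n : ℝ) + 2 := by push_cast; ring
      rw [hcast]
      congr 2
      refine Finset.sum_congr rfl fun k hk => ?_
      have hk' : k < n := Finset.mem_range.1 hk
      have e3 : n + 2 - 1 - k = n - 1 - k + 2 := by omega
      rw [e3]
    have hS1 : ∑ k ∈ Finset.range (n + 1), 2 * ((k : ℝ) + 1) * gegenbauerSum 1 (n + 1 - 1 - k) x =
        (∑ k ∈ Finset.range n, 2 * ((k : ℝ) + 1) * gegenbauerSum 1 (n - 1 - k + 1) x) +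
          2 * ((n : ℝ) + 1) * gegenbauerSum 1 0 x := by
      rw [Finset.sum_range_succ]
      have e2 : n + 1 - 1 - n = 0 := by omega
      rw [e2]
      congr 1
      refine Finset.sum_congr rfl fun k hk => ?_
      have hk' : k < n := Finset.mem_range.1 hk
      have e3 : n + 1 - 1 - k = n - 1 - k + 1 := by omega
      rw [e3]
    rw [hS1] at ih1
    rw [hS2, gegenbauerSum_one_succ_succ, gegenbauerSum_one, gegenbauerSum_zero]
    -- the recurrence inside the remaining sum
    have hsum : ∑ k ∈ Finset.range n, 2 * ((k : ℝ) + 1) * gegenbauerSum 1 (n - 1 - k + 2) x =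
        2 * x * (∑ k ∈ Finset.range n, 2 * ((k : ℝ) + 1) * gegenbauerSum 1 (n - 1 - k + 1) x) -
          ∑ k ∈ Finset.range n, 2 * ((k : ℝ) + 1) * gegenbauerSum 1 (n - 1 - k) x := by
      rw [Finset.mul_sum, ← Finset.sum_sub_distrib]
      refine Finset.sum_congr rfl fun k _ => ?_
      rw [gegenbauerSum_one_succ_succ]
      ring
    rw [hsum]
    -- `e_{n+2} = 2x e_{n+1} − e_n + 2(n+2)(1−x)` with the induction hypotheses
    have e_n : gegenbauerSum 1 n x = ((n : ℝ) + 1) -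
        (1 - x) * ∑ k ∈ Finset.range n, 2 * ((k : ℝ) + 1) * gegenbauerSum 1 (n - 1 - k) x := by linarith
    have e_n1 : gegenbauerSum 1 (n + 1) x = ((n + 1 : ℕ) : ℝ) + 1 -
        (1 - x) * (∑ k ∈ Finset.range n, 2 * ((k : ℝ) + 1) * gegenbauerSum 1 (n - 1 - k + 1) x +
          2 * ((n : ℝ) + 1) * gegenbauerSum 1 0 x) := by linarith
    rw [e_n, e_n1, gegenbauerSum_zero]
    push_cast
    ring

/-- `Σ_{k<n} 2(k+1)(n−k) = n(n+1)(n+2)/3`. [folklore] -/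
theorem sum_range_two_mul_succ_mul (n : ℕ) :
    ∑ k ∈ Finset.range n, 2 * ((k : ℝ) + 1) * ((n : ℝ) - k) = (n : ℝ) * ((n : ℝ) + 1) * ((n : ℝ) + 2) / 3 := by
  induction n with
  | zero => simp
  | succ n ih =>
    rw [Finset.sum_range_succ]
    have hshift : ∑ k ∈ Finset.range n, 2 * ((k : ℝ) + 1) * (((n + 1 : ℕ) : ℝ) - k) =
        (∑ k ∈ Finset.range n, 2 * ((k : ℝ) + 1) * ((n : ℝ) - k)) + ∑ k ∈ Finset.range n, 2 * ((k : ℝ) + 1) := by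
      rw [← Finset.sum_add_distrib]
      refine Finset.sum_congr rfl fun k _ => ?_
      push_cast; ring
    have harith : ∑ k ∈ Finset.range n, 2 * ((k : ℝ) + 1) = (n : ℝ) * ((n : ℝ) + 1) := by
      clear ih hshift
      induction n with
      | zero => simp
      | succ m ihm => rw [Finset.sum_range_succ, ihm]; push_cast; ring
    rw [hshift, ih, harith]
    push_cast
    ring

/-- ★ **Quadratic Markov-type bound for the Chebyshev deficiency**: for `|x| ≤ 1`,
`(n+1) − U_n(x) ≤ (1 − x) · n(n+1)(n+2)/3`. [folklore] -/
theorem sub_gegenbauerSum_one_le (n : ℕ) {x : ℝ} (hx : |x| ≤ 1) :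
    ((n : ℝ) + 1) - gegenbauerSum 1 n x ≤ (1 - x) * ((n : ℝ) * ((n : ℝ) + 1) * ((n : ℝ) + 2) / 3) := by
  rw [gegenbauerSum_one_deficiency, ← sum_range_two_mul_succ_mul]
  have h1x : 0 ≤ 1 - x := by linarith [(abs_le.1 hx).2]
  refine mul_le_mul_of_nonneg_left (Finset.sum_le_sum fun k hk => ?_) h1x
  have hk : k < n := Finset.mem_range.1 hk
  have hU : gegenbauerSum 1 (n - 1 - k) x ≤ ((n - 1 - k : ℕ) : ℝ) + 1 :=
    (le_abs_self _).trans (abs_gegenbauerSum_one_le _ hx)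
  have hcast : ((n - 1 - k : ℕ) : ℝ) + 1 = (n : ℝ) - k := by
    have : n - 1 - k + 1 = n - k := by omega
    have h2 : (((n - 1 - k + 1 : ℕ) : ℝ)) = ((n - k : ℕ) : ℝ) := by rw [this]
    push_cast at h2
    rw [h2, Nat.cast_sub hk.le]
  rw [hcast] at hU
  exact mul_le_mul_of_nonneg_left hU (by positivity)

/-- The deficiency is non-negative on `[-1, 1]`: `U_n(x) ≤ n + 1`. [folklore] -/
theorem gegenbauerSum_one_le (n : ℕ) {x : ℝ} (hx : |x| ≤ 1) : gegenbauerSum 1 n x ≤ (n : ℝ) + 1 :=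
  (le_abs_self _).trans (abs_gegenbauerSum_one_le n hx)

/-! ## The heat kernel near the identity -/

/-- The deficiency majorant `Σ (n+1) e^{-n(n+2)t/2} · n(n+1)(n+2)/3` is summable for `t > 0`. [folklore] -/
theorem summable_heatKernelSU2_deficiencyMajorant {t : ℝ} (ht : 0 < t) :
    Summable fun n : ℕ => ((n : ℝ) + 1) * Real.exp (-((n : ℝ) * ((n : ℝ) + 2) / 2) * t) *
      ((n : ℝ) * ((n : ℝ) + 1) * ((n : ℝ) + 2) / 3) := by
  -- compare with `(n+1)² (n+2)² e^{-t n}`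
  have h1 : Summable fun n : ℕ => (((n : ℝ) + 1) ^ 2 * ((n : ℝ) + 2) ^ 2) * Real.exp (-t * n) := by
    have h4 := Real.summable_pow_mul_exp_neg_nat_mul 4 ht
    have h3 := Real.summable_pow_mul_exp_neg_nat_mul 3 ht
    have h2 := Real.summable_pow_mul_exp_neg_nat_mul 2 ht
    have h1 := Real.summable_pow_mul_exp_neg_nat_mul 1 ht
    have h0 := Real.summable_pow_mul_exp_neg_nat_mul 0 ht
    have := (((h4.add (h3.mul_left 6)).add (h2.mul_left 13)).add (h1.mul_left 12)).add (h0.mul_left 4)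
    refine this.congr fun n => ?_
    simp only [pow_one, pow_zero, one_mul]; ring
  refine Summable.of_nonneg_of_le (fun n => by positivity) (fun n => ?_) h1
  have hn : (0 : ℝ) ≤ n := n.cast_nonneg
  have hexp : Real.exp (-((n : ℝ) * ((n : ℝ) + 2) / 2) * t) ≤ Real.exp (-t * n) := by
    refine Real.exp_le_exp.2 ?_
    have h2 : 0 ≤ t * n * n := by positivity
    nlinarith [h2]
  have hpoly : ((n : ℝ) + 1) * ((n : ℝ) * ((n : ℝ) + 1) * ((n : ℝ) + 2) / 3) ≤ ((n : ℝ) + 1) ^ 2 * ((n : ℝ) + 2) ^ 2 := by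
    nlinarith [hn, sq_nonneg ((n : ℝ) + 1), mul_nonneg hn hn]
  calc ((n : ℝ) + 1) * Real.exp (-((n : ℝ) * ((n : ℝ) + 2) / 2) * t) * ((n : ℝ) * ((n : ℝ) + 1) * ((n : ℝ) + 2) / 3)
      = (((n : ℝ) + 1) * ((n : ℝ) * ((n : ℝ) + 1) * ((n : ℝ) + 2) / 3)) * Real.exp (-((n : ℝ) * ((n : ℝ) + 2) / 2) * t) := by
        ring
    _ ≤ (((n : ℝ) + 1) ^ 2 * ((n : ℝ) + 2) ^ 2) * Real.exp (-t * n) :=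
        mul_le_mul hpoly hexp (Real.exp_pos _).le (by positivity)

/-- ★ **Local lower bound of the SU(2) heat kernel near the identity**: for `t > 0` and every `U ∈ SU(2)`,
`h_t(1) − h_t(U) ≤ (1 − Re tr U / 2) · D_t` with `D_t = Σ (n+1) e^{-n(n+2)t/2} n(n+1)(n+2)/3`. [folklore] -/
theorem heatKernelSU2_one_sub_le {t : ℝ} (ht : 0 < t) (U : Matrix.specialUnitaryGroup (Fin 2) ℂ) :
    (∑' n : ℕ, ((n : ℝ) + 1) * Real.exp (-((n : ℝ) * ((n : ℝ) + 2) / 2) * t) *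
        su2Char n (1 : Matrix.specialUnitaryGroup (Fin 2) ℂ)) -
      (∑' n : ℕ, ((n : ℝ) + 1) * Real.exp (-((n : ℝ) * ((n : ℝ) + 2) / 2) * t) * su2Char n U) ≤
      (1 - ((U : Matrix (Fin 2) (Fin 2) ℂ)).trace.re / 2) *
        ∑' n : ℕ, ((n : ℝ) + 1) * Real.exp (-((n : ℝ) * ((n : ℝ) + 2) / 2) * t) *
          ((n : ℝ) * ((n : ℝ) + 1) * ((n : ℝ) + 2) / 3) := by
  have hx : |((U : Matrix (Fin 2) (Fin 2) ℂ)).trace.re / 2| ≤ 1 := abs_re_trace_div_two_le U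
  have h1tr : (((1 : Matrix.specialUnitaryGroup (Fin 2) ℂ) : Matrix (Fin 2) (Fin 2) ℂ).trace.re / 2) = 1 := by
    simp [Matrix.trace]
  have hs1 := summable_heatKernelSU2 ht (1 : Matrix.specialUnitaryGroup (Fin 2) ℂ)
  have hsU := summable_heatKernelSU2 ht U
  have hsD := summable_heatKernelSU2_deficiencyMajorant ht
  rw [← Summable.tsum_sub hs1 hsU, ← tsum_mul_left]
  refine Summable.tsum_le_tsum (fun n => ?_) (hs1.sub hsU) (hsD.mul_left _)
  rw [su2Char_eq_gegenbauerSum, su2Char_eq_gegenbauerSum, h1tr, gegenbauerSum_one_at_one]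
  have hdef := sub_gegenbauerSum_one_le n hx
  have hpos : 0 ≤ ((n : ℝ) + 1) * Real.exp (-((n : ℝ) * ((n : ℝ) + 2) / 2) * t) := by positivity
  calc ((n : ℝ) + 1) * Real.exp (-((n : ℝ) * ((n : ℝ) + 2) / 2) * t) * ((n : ℝ) + 1) -
        ((n : ℝ) + 1) * Real.exp (-((n : ℝ) * ((n : ℝ) + 2) / 2) * t) *
          gegenbauerSum 1 n (((U : Matrix (Fin 2) (Fin 2) ℂ)).trace.re / 2)
      = ((n : ℝ) + 1) * Real.exp (-((n : ℝ) * ((n : ℝ) + 2) / 2) * t) *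
          (((n : ℝ) + 1) - gegenbauerSum 1 n (((U : Matrix (Fin 2) (Fin 2) ℂ)).trace.re / 2)) := by ring
    _ ≤ ((n : ℝ) + 1) * Real.exp (-((n : ℝ) * ((n : ℝ) + 2) / 2) * t) *
          ((1 - ((U : Matrix (Fin 2) (Fin 2) ℂ)).trace.re / 2) * ((n : ℝ) * ((n : ℝ) + 1) * ((n : ℝ) + 2) / 3)) :=
        mul_le_mul_of_nonneg_left hdef hpos
    _ = (1 - ((U : Matrix (Fin 2) (Fin 2) ℂ)).trace.re / 2) *
          (((n : ℝ) + 1) * Real.exp (-((n : ℝ) * ((n : ℝ) + 2) / 2) * t) * ((n : ℝ) * ((n : ℝ) + 1) * ((n : ℝ) + 2) / 3)) := by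
        ring

/-- **The heat kernel stays above half its value at the identity on a ball around it**: if
`(1 − Re tr U/2) · D_t ≤ h_t(1)/2` then `h_t(U) ≥ h_t(1)/2`. [folklore] -/
theorem heatKernelSU2_ge_half_of_near_one {t : ℝ} (ht : 0 < t) (U : Matrix.specialUnitaryGroup (Fin 2) ℂ)
    (hU : (1 - ((U : Matrix (Fin 2) (Fin 2) ℂ)).trace.re / 2) *
        (∑' n : ℕ, ((n : ℝ) + 1) * Real.exp (-((n : ℝ) * ((n : ℝ) + 2) / 2) * t) *
          ((n : ℝ) * ((n : ℝ) + 1) * ((n : ℝ) + 2) / 3)) ≤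
      (∑' n : ℕ, ((n : ℝ) + 1) * Real.exp (-((n : ℝ) * ((n : ℝ) + 2) / 2) * t) *
        su2Char n (1 : Matrix.specialUnitaryGroup (Fin 2) ℂ)) / 2) :
    (∑' n : ℕ, ((n : ℝ) + 1) * Real.exp (-((n : ℝ) * ((n : ℝ) + 2) / 2) * t) *
        su2Char n (1 : Matrix.specialUnitaryGroup (Fin 2) ℂ)) / 2 ≤
      ∑' n : ℕ, ((n : ℝ) + 1) * Real.exp (-((n : ℝ) * ((n : ℝ) + 2) / 2) * t) * su2Char n U := by
  have h := heatKernelSU2_one_sub_le ht U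
  linarith

end Summit.QuantumFields.YangMills.Theorems.ColdStartUniversality

end
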